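import Mathlib
import HarnessLib
import Summits.ABC.ABC.Theses.CongruentialReceptacle
import Summits.ABC.ABC.Theorems.CongruentialReceptacleCompactBalanceTransferSplit

/-!
# Crux `CompactBalanceTransfer` (stmt-ABC-1725) — strategist p1 companion: the D1 children by name,
# and what the Frey–Szpiro hypothesis `F` buys (the power-deep regime)

Companion to `Cruxes/CompactBalanceTransfer/STRATEGY-CENSUS.md` (rewritten 2026-08-17 by seat
`planner-cstrat-stmt-ABC-1725-p1-0`). Sorry-free.

* §1 The two children of the currency split D1 as they would appear in the route file
  (`BalancedToFreySzpiro := H → F`, `FreySzpiroToABC := F → ABC`, `F` = Szpiro `6+ε` for the Frey curves of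
  ALL abc-triples in elementary currency), closed BY NAME by the landed glue
  `Summit.ABC.ABC.Theorems.compactBalanceTransfer_of_subs` (p125050) — this is the exact term the gate has to
  elaborate for `ledger route edit … --split CompactBalanceTransfer --into children-D1.json --glue-by …`.
* §2 `F` ALONE gives abc with exponent `3/2 + ε` (`abc_threeHalves_of_freySzpiro`): the classical free bound
  (`(abc)² ≥ c⁴/4`), recorded so that no line on child 2 mistakes it for progress.
* §3 THE POWER-DEEP REFORMULATION of child 2 (census D5):
  `(F → ABC) ↔ (F → ∀ δ > 0, PowerDeepABC δ)`, where `PowerDeepABC δ` is abc on the power-deep cell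
  `log min(a,b) ≤ (1−δ)·log c` (i.e. `min(a,b) ≤ c^(1−δ)`). `F` pays for every triple OFF that cell
  (`(abc)² > c^(6−2δ)/4` there, so `F` gives exponent `(6+ε)(1+ε)/(6+4ε) ≤ 1+ε` with `δ = ε/(1+ε)`); the residual
  of Oesterlé's gap `Szpiro ⟹ abc` is therefore exactly Pasten's deep regime `min ≤ c^(1−δ)`. Relative depth
  `log(c/min)/log c` is preserved by power maps and lowered by squaring, never raised by a ℚ-correspondence, so —
  unlike the LINEAR depth cells of `Theorems/CompactBalanceTransfer/Negative/DepthCellDissolution.lean`, which are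
  all abc-complete — the power-deep cells are not known to carry all of abc: child 2 is a genuine weakening.
-/

set_option linter.dupNamespace false
set_option linter.unusedVariables false

namespace Summit.ABC.ABC.Cruxes.CompactBalanceTransfer.StrategyP1

open Literature.NumberTheory.DiophantineGeometry
open Summit.ABC.ABC.Theses.CongruentialReceptacle

/-! ## §0 Names -/

/-- `H`: abc with exponent `1+ε` on every compactly balanced cell (the hypothesis of the crux). -/
def BalancedABC : Prop :=
  ∀ κ : ℝ, 0 < κ → ∀ ε : ℝ, 0 < ε → ∃ C : ℝ, ∀ a b c : ℕ, IsABCTriple a b c →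
    κ * (c : ℝ) ≤ (a : ℝ) → κ * (c : ℝ) ≤ (b : ℝ) → (c : ℝ) < C * ((rad a b c : ℕ) : ℝ) ^ (1 + ε)

/-- `F`: Szpiro `6+ε` for the Frey curves of ALL abc-triples, elementary currency (`2⁸Δ_min = (abc)²`,
`N = rad(abc)`): `(abc)² ≤ C·rad(abc)^(6+ε)`. -/
def FreySzpiroAll : Prop :=
  ∀ ε : ℝ, 0 < ε → ∃ C : ℝ, ∀ a b c : ℕ, IsABCTriple a b c →
    ((a * b * c : ℕ) : ℝ) ^ 2 ≤ C * ((rad a b c : ℕ) : ℝ) ^ (6 + ε)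

/-- Child 1 of D1 (keeps `H`): balanced abc ⟹ Frey–Szpiro for all triples. -/
def BalancedToFreySzpiro : Prop := BalancedABC → FreySzpiroAll

/-- Child 2 of D1 (balance-free): Frey–Szpiro ⟹ abc — Oesterlé's open implication. -/
def FreySzpiroToABC : Prop := FreySzpiroAll → _root_.ABC

/-- abc on the POWER-DEEP cell of relative depth `δ`: `log min(a,b) ≤ (1 − δ)·log c`, i.e. `min(a,b) ≤ c^(1−δ)`
(log form, to keep real powers of naturals out of the hypothesis). -/
def PowerDeepABC (δ : ℝ) : Prop :=
  ∀ ε : ℝ, 0 < ε → ∃ C : ℝ, ∀ a b c : ℕ, IsABCTriple a b c →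
    Real.log ((min a b : ℕ) : ℝ) ≤ (1 - δ) * Real.log (c : ℝ) →
      (c : ℝ) < C * ((rad a b c : ℕ) : ℝ) ^ (1 + ε)

/-! ## §1 The split, by name -/

theorem crux_iff_H_to_abc : CompactBalanceTransfer ↔ (BalancedABC → _root_.ABC) := Iff.rfl

/-- The landed glue closes the parent from the two children (term the gate elaborates for `--glue-by`). -/
theorem crux_of_children : BalancedToFreySzpiro → FreySzpiroToABC → CompactBalanceTransfer :=
  Summit.ABC.ABC.Theorems.compactBalanceTransfer_of_subs

/-- Exactness: the parent is equivalent to the conjunction of its children. -/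
theorem crux_iff_children : CompactBalanceTransfer ↔ (BalancedToFreySzpiro ∧ FreySzpiroToABC) :=
  Summit.ABC.ABC.Theorems.compactBalanceTransfer_iff_subs

/-- Child 2 is implied by `ABC` (so irrefutable short of `¬ABC`) … -/
theorem child2_of_abc (h : _root_.ABC) : FreySzpiroToABC := fun _ => h

/-- … and so is child 1. -/
theorem child1_of_abc (h : _root_.ABC) : BalancedToFreySzpiro :=
  fun _ => Summit.ABC.ABC.Theorems.freySzpiroAll_of_abc h

/-! ## §2 `F` alone: exponent `3/2` -/

/-- Basic facts about an abc triple used below: positivity, `c ≥ 2`, `ab ≥ c/2`, radical `≥ 1`. -/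
theorem two_mul_ab_ge {a b c : ℕ} (h : IsABCTriple a b c) : c ≤ 2 * (a * b) := by
  obtain ⟨ha, hb, hsum, _⟩ := h
  subst hsum
  nlinarith

theorem rad_pos' (a b c : ℕ) : 0 < rad a b c := by
  rw [rad_def]; exact Nat.pos_of_ne_zero UniqueFactorizationMonoid.radical_ne_zero

/-- **`F` gives abc with exponent `3/2 + ε`.** From `(abc)² ≤ C·rad^(6+4ε)` and `abc ≥ c·(c/2)`:
`c⁴/4 ≤ C·rad^(6+4ε)`, so `c ≤ (4C)^(1/4)·rad^(3/2+ε)`. [folklore; Oesterlé 1988] -/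
theorem abc_threeHalves_of_freySzpiro (hF : FreySzpiroAll) :
    ∀ ε : ℝ, 0 < ε → ∃ C : ℝ, 0 < C ∧ ∀ a b c : ℕ, IsABCTriple a b c →
      (c : ℝ) < C * ((rad a b c : ℕ) : ℝ) ^ (3 / 2 + ε) := by
  intro ε hε
  obtain ⟨CF, hCF⟩ := hF (4 * ε) (by positivity)
  set CF' : ℝ := max CF 1 with hCF'def
  have hCF'1 : (1 : ℝ) ≤ CF' := le_max_right _ _
  have hCF'pos : (0 : ℝ) < CF' := lt_of_lt_of_le one_pos hCF'1
  set K : ℝ := (Real.log CF' + 2 * Real.log 2) / 4 + 1 with hKdef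
  refine ⟨Real.exp K, Real.exp_pos K, fun a b c habc => ?_⟩
  have hF0 := hCF a b c habc
  have hab2 := two_mul_ab_ge habc
  obtain ⟨ha0, hb0, hsum, _⟩ := habc
  have hcpos : (0 : ℝ) < c := by exact_mod_cast (show 0 < c by omega)
  have hapos : (0 : ℝ) < a := by exact_mod_cast ha0
  have hbpos : (0 : ℝ) < b := by exact_mod_cast hb0
  have hRpos : (0 : ℝ) < ((rad a b c : ℕ) : ℝ) := by exact_mod_cast rad_pos' a b c
  have hR1 : (1 : ℝ) ≤ ((rad a b c : ℕ) : ℝ) := by exact_mod_cast rad_pos' a b c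
  have hlogR : 0 ≤ Real.log ((rad a b c : ℕ) : ℝ) := Real.log_nonneg hR1
  have habcpos : (0 : ℝ) < ((a * b * c : ℕ) : ℝ) := by push_cast; positivity
  -- F in logarithms
  have hXnn : (0 : ℝ) ≤ ((rad a b c : ℕ) : ℝ) ^ (6 + 4 * ε) := Real.rpow_nonneg hRpos.le _
  have hXpos : (0 : ℝ) < ((rad a b c : ℕ) : ℝ) ^ (6 + 4 * ε) := Real.rpow_pos_of_pos hRpos _
  have hF1 : ((a * b * c : ℕ) : ℝ) ^ 2 ≤ CF' * ((rad a b c : ℕ) : ℝ) ^ (6 + 4 * ε) :=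
    le_trans hF0 (mul_le_mul_of_nonneg_right (le_max_left _ _) hXnn)
  have hlogF : 2 * Real.log ((a * b * c : ℕ) : ℝ) ≤
      Real.log CF' + (6 + 4 * ε) * Real.log ((rad a b c : ℕ) : ℝ) := by
    have h := Real.log_le_log (by positivity) hF1
    have e2 : Real.log (((a * b * c : ℕ) : ℝ) ^ 2) = 2 * Real.log ((a * b * c : ℕ) : ℝ) := by
      rw [Real.log_pow]; norm_num
    rw [e2, Real.log_mul hCF'pos.ne' hXpos.ne', Real.log_rpow hRpos] at h
    linarith
  -- lower bound: log(abc) ≥ 2 log c − log 2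
  have hlow : 2 * Real.log c - Real.log 2 ≤ Real.log ((a * b * c : ℕ) : ℝ) := by
    have hab2' : (c : ℝ) ≤ 2 * ((a : ℝ) * b) := by exact_mod_cast hab2
    have e : Real.log ((a * b * c : ℕ) : ℝ) = Real.log ((a : ℝ) * b) + Real.log c := by
      push_cast
      rw [Real.log_mul (by positivity) hcpos.ne']
    have h1 : Real.log c ≤ Real.log 2 + Real.log ((a : ℝ) * b) := by
      have := Real.log_le_log hcpos hab2'
      rwa [Real.log_mul (by norm_num) (by positivity)] at this
    rw [e]; linarith
  -- combine: 4 log c − 2 log 2 ≤ log CF' + (6+4ε) log rad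
  have hlogc : Real.log c < K + (3 / 2 + ε) * Real.log ((rad a b c : ℕ) : ℝ) := by
    have : 4 * Real.log c ≤ Real.log CF' + 2 * Real.log 2 + (6 + 4 * ε) * Real.log ((rad a b c : ℕ) : ℝ) := by
      linarith
    rw [hKdef]
    nlinarith
  calc (c : ℝ) = Real.exp (Real.log c) := (Real.exp_log hcpos).symm
    _ < Real.exp (K + (3 / 2 + ε) * Real.log ((rad a b c : ℕ) : ℝ)) := Real.exp_lt_exp.mpr hlogc
    _ = Real.exp K * ((rad a b c : ℕ) : ℝ) ^ (3 / 2 + ε) := by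
        rw [Real.exp_add, Real.rpow_def_of_pos hRpos, mul_comm (Real.log _) (3 / 2 + ε)]

/-! ## §3 What `F` buys: the power-deep reformulation of child 2 -/

/-- **`F` plus abc on every power-deep cell gives abc.** For `ε > 0` put `δ := ε/(1+ε)`. Deep triples
(`log min ≤ (1−δ) log c`) are covered by `PowerDeepABC δ` at `ε`; off the cell, `log(abc) > (3−δ)·log c − log 2`
(the large member is `≥ c/2`) and `F` at `ε` give `(6−2δ)·log c < log C + 2 log 2 + (6+ε)·log rad`, and
`6 − 2δ = (6+4ε)/(1+ε)`, `(6+ε)/(6+4ε) ≤ 1`. [folklore] -/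
theorem abc_of_freySzpiro_of_powerDeep (hF : FreySzpiroAll) (hD : ∀ δ : ℝ, 0 < δ → PowerDeepABC δ) :
    _root_.ABC := by
  rw [_root_.ABC_iff]
  intro ε hε
  have h1ε : (0 : ℝ) < 1 + ε := by positivity
  have h64 : (0 : ℝ) < 6 + 4 * ε := by positivity
  set δ : ℝ := ε / (1 + ε) with hδdef
  have hδpos : 0 < δ := by rw [hδdef]; positivity
  have h62δ : 6 - 2 * δ = (6 + 4 * ε) / (1 + ε) := by
    rw [hδdef]; field_simp; ring
  obtain ⟨CD, hCD⟩ := hD δ hδpos ε hε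
  obtain ⟨CF, hCF⟩ := hF ε hε
  set CF' : ℝ := max CF 1 with hCF'def
  have hCF'1 : (1 : ℝ) ≤ CF' := le_max_right _ _
  have hCF'pos : (0 : ℝ) < CF' := lt_of_lt_of_le one_pos hCF'1
  set K : ℝ := (1 + ε) / (6 + 4 * ε) * (Real.log CF' + 2 * Real.log 2) with hKdef
  refine ⟨max CD (Real.exp K), lt_max_of_lt_right (Real.exp_pos K), fun a b c habc => ?_⟩
  have hRpos : (0 : ℝ) < ((rad a b c : ℕ) : ℝ) := by exact_mod_cast rad_pos' a b c
  have hR1 : (1 : ℝ) ≤ ((rad a b c : ℕ) : ℝ) := by exact_mod_cast rad_pos' a b c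
  have hlogR : 0 ≤ Real.log ((rad a b c : ℕ) : ℝ) := Real.log_nonneg hR1
  have hX1 : (0 : ℝ) ≤ ((rad a b c : ℕ) : ℝ) ^ (1 + ε) := Real.rpow_nonneg hRpos.le _
  by_cases hdeep : Real.log ((min a b : ℕ) : ℝ) ≤ (1 - δ) * Real.log (c : ℝ)
  · -- deep: covered by the power-deep cell hypothesis
    calc (c : ℝ) < CD * ((rad a b c : ℕ) : ℝ) ^ (1 + ε) := hCD a b c habc hdeep
      _ ≤ max CD (Real.exp K) * ((rad a b c : ℕ) : ℝ) ^ (1 + ε) :=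
          mul_le_mul_of_nonneg_right (le_max_left _ _) hX1
  · -- off the cell: F pays
    push Not at hdeep
    have hF0 := hCF a b c habc
    obtain ⟨ha0, hb0, hsum, _⟩ := habc
    have hcpos : (0 : ℝ) < c := by exact_mod_cast (show 0 < c by omega)
    have hapos : (0 : ℝ) < a := by exact_mod_cast ha0
    have hbpos : (0 : ℝ) < b := by exact_mod_cast hb0
    have habcpos : (0 : ℝ) < ((a * b * c : ℕ) : ℝ) := by push_cast; positivity
    have hXnn : (0 : ℝ) ≤ ((rad a b c : ℕ) : ℝ) ^ (6 + ε) := Real.rpow_nonneg hRpos.le _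
    have hXpos : (0 : ℝ) < ((rad a b c : ℕ) : ℝ) ^ (6 + ε) := Real.rpow_pos_of_pos hRpos _
    have hF1 : ((a * b * c : ℕ) : ℝ) ^ 2 ≤ CF' * ((rad a b c : ℕ) : ℝ) ^ (6 + ε) :=
      le_trans hF0 (mul_le_mul_of_nonneg_right (le_max_left _ _) hXnn)
    have hlogF : 2 * Real.log ((a * b * c : ℕ) : ℝ) ≤
        Real.log CF' + (6 + ε) * Real.log ((rad a b c : ℕ) : ℝ) := by
      have h := Real.log_le_log (by positivity) hF1
      have e2 : Real.log (((a * b * c : ℕ) : ℝ) ^ 2) = 2 * Real.log ((a * b * c : ℕ) : ℝ) := by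
        rw [Real.log_pow]; norm_num
      rw [e2, Real.log_mul hCF'pos.ne' hXpos.ne', Real.log_rpow hRpos] at h
      linarith
    -- lower bound: log(abc) > (3 − δ) log c − log 2
    have e : Real.log ((a * b * c : ℕ) : ℝ) = Real.log a + Real.log b + Real.log c := by
      push_cast
      rw [Real.log_mul (by positivity) hcpos.ne', Real.log_mul hapos.ne' hbpos.ne']
    have hlow : (3 - δ) * Real.log c - Real.log 2 < Real.log ((a * b * c : ℕ) : ℝ) := by
      rcases le_total a b with hab | hab
      · have hmin : ((min a b : ℕ) : ℝ) = (a : ℝ) := by rw [min_eq_left hab]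
        rw [hmin] at hdeep
        have hb2 : (c : ℝ) ≤ 2 * (b : ℝ) := by exact_mod_cast (show c ≤ 2 * b by omega)
        have hlogb : Real.log c ≤ Real.log 2 + Real.log b := by
          have := Real.log_le_log hcpos hb2
          rwa [Real.log_mul (by norm_num) hbpos.ne'] at this
        rw [e]; linarith
      · have hmin : ((min a b : ℕ) : ℝ) = (b : ℝ) := by rw [min_eq_right hab]
        rw [hmin] at hdeep
        have ha2 : (c : ℝ) ≤ 2 * (a : ℝ) := by exact_mod_cast (show c ≤ 2 * a by omega)
        have hloga : Real.log c ≤ Real.log 2 + Real.log a := by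
          have := Real.log_le_log hcpos ha2
          rwa [Real.log_mul (by norm_num) hapos.ne'] at this
        rw [e]; linarith
    -- combine
    have hcomb : (6 + 4 * ε) / (1 + ε) * Real.log c <
        Real.log CF' + 2 * Real.log 2 + (6 + ε) * Real.log ((rad a b c : ℕ) : ℝ) := by
      rw [← h62δ]; linarith
    have hlogc : Real.log c < K + (1 + ε) * Real.log ((rad a b c : ℕ) : ℝ) := by
      have hmul := mul_lt_mul_of_pos_left hcomb (div_pos h1ε h64)
      have e1 : (1 + ε) / (6 + 4 * ε) * ((6 + 4 * ε) / (1 + ε) * Real.log c) = Real.log c := by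
        field_simp
      have e2 : (1 + ε) / (6 + 4 * ε) *
          (Real.log CF' + 2 * Real.log 2 + (6 + ε) * Real.log ((rad a b c : ℕ) : ℝ)) =
          K + (1 + ε) * ((6 + ε) / (6 + 4 * ε)) * Real.log ((rad a b c : ℕ) : ℝ) := by
        rw [hKdef]; field_simp
      rw [e1, e2] at hmul
      have hfrac : (6 + ε) / (6 + 4 * ε) ≤ 1 := by
        rw [div_le_one h64]; linarith
      have hle : (1 + ε) * ((6 + ε) / (6 + 4 * ε)) * Real.log ((rad a b c : ℕ) : ℝ) ≤
          (1 + ε) * Real.log ((rad a b c : ℕ) : ℝ) := by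
        have h1 : (1 + ε) * ((6 + ε) / (6 + 4 * ε)) ≤ (1 + ε) * 1 :=
          mul_le_mul_of_nonneg_left hfrac h1ε.le
        have h2 := mul_le_mul_of_nonneg_right h1 hlogR
        simpa using h2
      linarith
    calc (c : ℝ) = Real.exp (Real.log c) := (Real.exp_log hcpos).symm
      _ < Real.exp (K + (1 + ε) * Real.log ((rad a b c : ℕ) : ℝ)) := Real.exp_lt_exp.mpr hlogc
      _ = Real.exp K * ((rad a b c : ℕ) : ℝ) ^ (1 + ε) := by
          rw [Real.exp_add, Real.rpow_def_of_pos hRpos, mul_comm (Real.log _) (1 + ε)]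
      _ ≤ max CD (Real.exp K) * ((rad a b c : ℕ) : ℝ) ^ (1 + ε) :=
          mul_le_mul_of_nonneg_right (le_max_right _ _) hX1

/-- `ABC` restricts to every power-deep cell. -/
theorem powerDeep_of_abc (h : _root_.ABC) (δ : ℝ) : PowerDeepABC δ := by
  intro ε hε
  obtain ⟨C, _, hC⟩ := (_root_.ABC_iff.mp h) ε hε
  exact ⟨C, fun a b c habc _ => hC a b c habc⟩

/-- **Child 2 reformulated (census D5).** Oesterlé's implication `F → ABC` is equivalent to
`F →` abc on every power-deep cell `min(a,b) ≤ c^(1−δ)`: the Frey–Szpiro hypothesis pays for every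
triple of relative depth `< δ`, so its residual is exactly the power-deep regime. [folklore] -/
theorem freySzpiroToABC_iff_powerDeep :
    FreySzpiroToABC ↔ (FreySzpiroAll → ∀ δ : ℝ, 0 < δ → PowerDeepABC δ) :=
  ⟨fun h hF δ _ => powerDeep_of_abc (h hF) δ,
   fun h hF => abc_of_freySzpiro_of_powerDeep hF (h hF)⟩

/-- Hence the parent crux, too, reduces to: `H → F`, and `F →` abc on the power-deep cells. -/
theorem crux_of_children' (h₁ : BalancedToFreySzpiro)
    (h₂ : FreySzpiroAll → ∀ δ : ℝ, 0 < δ → PowerDeepABC δ) : CompactBalanceTransfer :=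
  crux_of_children h₁ (freySzpiroToABC_iff_powerDeep.mpr h₂)

end Summit.ABC.ABC.Cruxes.CompactBalanceTransfer.StrategyP1
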